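import Summits.Schanuel.Schanuel.Theorems.DiophantineDichotomyKhovanskiiApproxTypeEvAnchoredSyncFloor
import HarnessLib

/-!
# The flagship floors (`stub_flagshipFloorHalf`) — crux `DiophantineDichotomy.KhovanskiiApproxTypeEv`
# (stmt-Schanuel-14972), line `Sketch`, sub-goal K (skeleton v15)

Line `Sketch` of crux `Summit.Schanuel.Schanuel.Theses.DiophantineDichotomy.KhovanskiiApproxTypeEv`
(stmt-Schanuel-14972), skeleton v16 (lead `prover-line-stmt-Schanuel-14972-c14-0`), registered stubs
`stub_anchoredSyncFloor` (sub-goal J) and `stub_flagshipFloorHalf` (sub-goal K) — `--supports stmt-Schanuel-14972`.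
Instances of the anchored synchronised floor engine (sub-goal J₀ `stub_anchoredSyncCore`, `…EvAnchoredSyncFloor.lean`):

* `stub_anchoredSyncFloor` — at `θ = (s, e^s)` with ONE anchor coordinate `s_{k₀}` (arbitrary, `e^{s_{k₀}}`
  algebraic) and all other `s_k` algebraic non-zero, no eventual type with `a < 1/n`.

* `stub_flagshipFloorHalf` — at the FLAGSHIP point `(1, iπ)` (the only `n = 2` point the route consumes after
  the anchored reduction; leaf A `EvNonLWTwo` there is the route item `EPiSimultaneousTypeEv`) no eventual
  approximation type has `a < 1/2`: anchor `iπ` (`e^{iπ} = −1`), synchronised slot `e`, common field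
  `ℚ(α_π, α_e)` of degree `≤ m²`.  `Cruxes/KhovanskiiApproxTypeEv/Disproof.lean` §(c) had the floor `1/2` at
  `n = 2` only at the auxiliary conjugate points `(1+i, 1−i)`, `(λ, λ̄)`.
* `approxTypeEvAt_anchoredFamily_exponent_ge` — on the anchored family `(1, iπ, β₃, …, β_{n+2})` with
  algebraic non-zero tail the floor is `1/(n+2)`, against the demand `a < 1/(n+1)` of
  `KhovanskiiApproxTypeEvAnchored`; its `n = 1` case puts leaf C's window at `(1, iπ, β)` into `[1/3, 1/2)`.
* `not_approxTypeEvAt_oneExpOne_of_lt_half` — the same floor `1/2` at `(1, e)` (leaf A's "`e ⊥ e^e`" point):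
  anchor `e^e`, and the value `e` occupying both `s₂` and `e^{s₁}` is ONE synchronised target.
* `epiSimultaneousTypeEv_exponent_ge_half`, `epiSimultaneousTypeEv_window` — the route item
  `EPiSimultaneousTypeEv` (stmt-Schanuel-14975, stated with `a < 1`) cannot hold with `a < 1/2`, UNCONDITIONALLY:
  `Theorems/EPiSimultaneousTypeEv/Negative/CoordinatewiseLinear.lean` had this modulo the coordinatewise linear
  approximability `hB` of `(π, e)` ("Bugeaud 2003 + `e` is an S-number", not vendored); the anchor `π` and the
  synchronised slot `e` make `hB` unnecessary.
Everything is proved; no named facts.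
-/

noncomputable section

set_option linter.dupNamespace false

namespace Summit.Schanuel.Schanuel.Cruxes.KhovanskiiApproxTypeEv.AnchoredReduction

open Polynomial

/-! ## Sub-goal J: the anchored floor in the crux's vocabulary -/

/-- **SUB-GOAL J — the anchored Dirichlet floor `a ≥ 1/n`.**  Let `s ∈ ℂⁿ` have one ANCHOR coordinate
`s_{k₀}` — arbitrary, except that `e^{s_{k₀}}` is algebraic (e.g. `s_{k₀} = iπ`, `log 2`) — and all other
coordinates algebraic and non-zero.  Then `θ = (s, e^s)` admits no eventual approximation type `(a, b, C)`
with `a < 1/n`: the anchor is approximated by Diaz's theorem at a free scale, the `n − 1` slots `e^{s_k}`,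
`k ≠ k₀`, by synchronised Diaz slots (sub-goal H), everything else is algebraic (`stub_anchoredSyncCore`
with `Sy = inr '' {k ≠ k₀}`).  Instances: the flagship `(1, iπ)` (floor `1/2`, leaf A's only route-relevant
point), the anchored family `(1, iπ, β₃, …)` with algebraic tail (floor `1/(n+2)` against the demand
`a < 1/(n+1)` of `KhovanskiiApproxTypeEvAnchored`). [cite: Bugeaud2004, Thm 8.11] -/
theorem stub_anchoredSyncFloor : ∀ (n : ℕ) (s : Fin n → ℂ) (k₀ : Fin n) (a b C : ℝ),
    (∀ k, k ≠ k₀ → IsAlgebraic ℚ (s k)) → (∀ k, k ≠ k₀ → s k ≠ 0) →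
    IsAlgebraic ℚ (Complex.exp (s k₀)) → a < 1 / (n : ℝ) → ¬ ApproxTypeEvAt n s a b C := by
  intro n s k₀ a b C halg hs0 hexp ha
  rintro ⟨hC, hall⟩
  classical
  have hn : 1 ≤ n := k₀.pos
  refine stub_anchoredSyncCore (Sum.elim s (Complex.exp ∘ s)) (Sum.inl k₀)
    ((Finset.univ.erase k₀).map ⟨Sum.inr, Sum.inr_injective⟩) (by simp) ?_ ?_ a b C hC ?_ hall
  · intro i hi
    simp only [Finset.mem_map, Finset.mem_erase, Finset.mem_univ, Function.Embedding.coeFn_mk] at hi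
    obtain ⟨k, ⟨hk, -⟩, rfl⟩ := hi
    exact ⟨s k, halg k hk, hs0 k hk, rfl⟩
  · rintro (k | k) hk hk0
    · have hkk : k ≠ k₀ := fun h => hk0 (by rw [h])
      simpa using halg k hkk
    · have hkk : k = k₀ := by
        by_contra h
        exact hk (by simp [h])
      subst hkk
      simpa using hexp
  · have hcard : (((Finset.univ.erase k₀).map ⟨Sum.inr, Sum.inr_injective⟩).image
        (Sum.elim s (Complex.exp ∘ s))).card ≤ n - 1 := by
      refine Finset.card_image_le.trans ?_
      rw [Finset.card_map, Finset.card_erase_of_mem (Finset.mem_univ _), Finset.card_univ, Fintype.card_fin]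
    have hcast : ((n - 1 : ℕ) : ℝ) + 1 = (n : ℝ) := by
      rw [Nat.cast_sub hn]; push_cast; ring
    refine ha.trans_le (one_div_le_one_div_of_le (by positivity) ?_)
    rw [← hcast]
    exact_mod_cast Nat.add_le_add_right hcard 1

/-- **Pointwise window at anchored points, lower end:** any eventual type at such a point has `a ≥ 1/n`.
[cite: Bugeaud2004, Thm 8.11] -/
theorem approxTypeEvAt_anchor_exponent_ge {n : ℕ} (s : Fin n → ℂ) (k₀ : Fin n)
    (halg : ∀ k, k ≠ k₀ → IsAlgebraic ℚ (s k)) (hs0 : ∀ k, k ≠ k₀ → s k ≠ 0)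
    (hexp : IsAlgebraic ℚ (Complex.exp (s k₀))) {a b C : ℝ} (h : ApproxTypeEvAt n s a b C) :
    1 / (n : ℝ) ≤ a := by
  by_contra hlt
  exact stub_anchoredSyncFloor n s k₀ a b C halg hs0 hexp (not_le.mp hlt) h

/-- `e^{iπ} = −1` is algebraic. [folklore] -/
theorem isAlgebraic_exp_I_mul_pi : IsAlgebraic ℚ (Complex.exp (Complex.I * Real.pi)) := by
  rw [mul_comm, Complex.exp_pi_mul_I]
  exact isAlgebraic_one.neg

/-- **SUB-GOAL K — the flagship point `(1, iπ)`: no eventual approximation type with `a < 1/2`** — unconditionally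
(anchor `iπ` with `e^{iπ} = −1`, synchronised slot `e`; common field `ℚ(α_π, α_e)` of degree `≤ m²`).
This is the lower end `1/2` of the window of leaf A (`EvNonLWTwo`) AT THE ROUTE'S ONLY `n = 2` POINT
(`Disproof.lean` §(c) had it only at the auxiliary conjugate points `(1+i, 1−i)`, `(λ, λ̄)`).
[cite: Bugeaud2004, Thm 8.11] -/
theorem stub_flagshipFloorHalf : ∀ (a b C : ℝ), a < 1 / 2 →
    ¬ ApproxTypeEvAt 2 ![(1 : ℂ), Complex.I * Real.pi] a b C := by
  intro a b C ha
  refine stub_anchoredSyncFloor 2 _ 1 a b C ?_ ?_ (by simpa using isAlgebraic_exp_I_mul_pi)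
    (by norm_num at ha ⊢; exact ha)
  · intro k hk
    obtain rfl : k = 0 := by fin_cases k <;> simp_all
    simpa using isAlgebraic_one
  · intro k hk
    obtain rfl : k = 0 := by fin_cases k <;> simp_all
    simp

/-- **The anchored family with algebraic tail:** at `s = (1, iπ, β₃, …, β_{n+2})`, `βⱼ ≠ 0` algebraic, every
eventual approximation type has `a ≥ 1/(n+2)` — against the demand `a < 1/(n+1)` of
`KhovanskiiApproxTypeEvAnchored` (the crux on the anchored family; window `[1/(n+2), 1/(n+1))`).
[cite: Bugeaud2004, Thm 8.11] -/
theorem approxTypeEvAt_anchoredFamily_exponent_ge {n : ℕ} (s : Fin (n + 2) → ℂ) (h0 : s 0 = 1)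
    (h1 : s 1 = Complex.I * Real.pi)
    (halg : ∀ k : Fin (n + 2), k ≠ 0 → k ≠ 1 → IsAlgebraic ℚ (s k))
    (hs0 : ∀ k : Fin (n + 2), k ≠ 0 → k ≠ 1 → s k ≠ 0) {a b C : ℝ}
    (h : ApproxTypeEvAt (n + 2) s a b C) : 1 / ((n + 2 : ℕ) : ℝ) ≤ a := by
  refine approxTypeEvAt_anchor_exponent_ge s 1 (fun k hk => ?_) (fun k hk => ?_)
    (by rw [h1]; exact isAlgebraic_exp_I_mul_pi) h
  · by_cases hk0 : k = 0
    · subst hk0; rw [h0]; exact isAlgebraic_one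
    · exact halg k hk0 hk
  · by_cases hk0 : k = 0
    · subst hk0; rw [h0]; exact one_ne_zero
    · exact hs0 k hk0 hk

/-- Leaf A's window AT THE FLAGSHIP POINT: any eventual type at `(1, iπ)` has `1/2 ≤ a` (leaf `EvNonLWTwo` demands
`a < 1` there). [cite: Bugeaud2004, Thm 8.11] -/
theorem approxTypeEvAt_onePiI_exponent_ge_half {a b C : ℝ}
    (h : ApproxTypeEvAt 2 ![(1 : ℂ), Complex.I * Real.pi] a b C) : 1 / 2 ≤ a := by
  by_contra hlt
  exact stub_flagshipFloorHalf a b C (not_le.mp hlt) h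

/-- Leaf C's window at the anchored rank-3 points `(1, iπ, β)`, `β ≠ 0` algebraic (in the scope of
`EvNonLWRankThreeUp`, which demands `a < 1/2` there): every eventual type has `1/3 ≤ a`.
[cite: Bugeaud2004, Thm 8.11] -/
theorem approxTypeEvAt_onePiIBeta_exponent_ge_third (β : ℂ) (hβ : IsAlgebraic ℚ β) (hβ0 : β ≠ 0) {a b C : ℝ}
    (h : ApproxTypeEvAt 3 ![(1 : ℂ), Complex.I * Real.pi, β] a b C) : 1 / 3 ≤ a := by
  have key := approxTypeEvAt_anchoredFamily_exponent_ge (n := 1) ![(1 : ℂ), Complex.I * Real.pi, β] rfl rfl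
    (fun k hk0 hk1 => ?_) (fun k hk0 hk1 => ?_) h
  · norm_num at key ⊢; exact key
  · obtain rfl : k = 2 := by fin_cases k <;> simp_all
    simpa using hβ
  · obtain rfl : k = 2 := by fin_cases k <;> simp_all
    simpa using hβ0

/-- **The point `(1, e)`** (a free Khovanskii point through `e^{s₁} = s₂`; leaf A's "`e ⊥ e^e`" point,
`…EvExpExp.lean` p139808): **no eventual approximation type with `a < 1/2`** — anchor `e^e` (no hypothesis on
it is needed), and the value `e`, which occupies BOTH the coordinate `s₂` and the slot `e^{s₁}`, is ONE
synchronised target (one approximant `α_e` serves both coordinates); common field `ℚ(α_e, α₀)` of degree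
`≤ m²`. [cite: Bugeaud2004, Thm 8.11] -/
theorem not_approxTypeEvAt_oneExpOne_of_lt_half (a b C : ℝ) (ha : a < 1 / 2) :
    ¬ ApproxTypeEvAt 2 ![(1 : ℂ), Complex.exp 1] a b C := by
  rintro ⟨hC, hall⟩
  classical
  refine stub_anchoredSyncCore (Sum.elim ![(1 : ℂ), Complex.exp 1] (Complex.exp ∘ ![(1 : ℂ), Complex.exp 1]))
    (Sum.inr 1) {Sum.inl 1, Sum.inr 0} (by simp) ?_ ?_ a b C hC ?_ hall
  · intro i hi
    simp only [Finset.mem_insert, Finset.mem_singleton] at hi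
    rcases hi with rfl | rfl
    · exact ⟨1, isAlgebraic_one, one_ne_zero, by simp⟩
    · exact ⟨1, isAlgebraic_one, one_ne_zero, by simp⟩
  · rintro (i | i) hi hi0
    · fin_cases i
      · simpa using isAlgebraic_one
      · simp at hi
    · fin_cases i
      · simp at hi
      · simp at hi0
  · have himg : ({Sum.inl 1, Sum.inr 0} : Finset (Fin 2 ⊕ Fin 2)).image
        (Sum.elim ![(1 : ℂ), Complex.exp 1] (Complex.exp ∘ ![(1 : ℂ), Complex.exp 1])) = {Complex.exp 1} := by
      ext x; simp
    rw [himg, Finset.card_singleton]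
    norm_num at ha ⊢
    exact ha

/-- Leaf A's window at `(1, e)`: any eventual type there has `1/2 ≤ a`. [cite: Bugeaud2004, Thm 8.11] -/
theorem approxTypeEvAt_oneExpOne_exponent_ge_half {a b C : ℝ}
    (h : ApproxTypeEvAt 2 ![(1 : ℂ), Complex.exp 1] a b C) : 1 / 2 ≤ a := by
  by_contra hlt
  exact not_approxTypeEvAt_oneExpOne_of_lt_half a b C (not_le.mp hlt) h

/-- **Item `EPiSimultaneousTypeEv` (stmt-Schanuel-14975) cannot hold with `a < 1/2` — unconditionally.**
`Theorems/EPiSimultaneousTypeEv/Negative/CoordinatewiseLinear.lean` proved this MODULO the coordinatewise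
linear approximability `hB` of `(π, e)` ("Bugeaud 2003 + `e` is an S-number", not vendored); here `hB` is not
needed: the anchor `π` (Diaz at a free scale) and the synchronised slot `e` (sub-goal H) give, past every
threshold, challengers `(α_π, α_e)` of common field degree `≤ m²` within `max(exp(−0.006(m log M(α_π) +
deg α_π log M)), exp(−q m log M'))` of `(π, e)`. [cite: Bugeaud2004, Thm 8.11] -/
theorem epiSimultaneousTypeEv_exponent_ge_half :
    ¬ ∃ a b C : ℝ, a < 1 / 2 ∧ 0 < C ∧ ∀ d : ℕ, ∃ H₀ : ℕ, ∀ (H : ℕ) (γ : Fin 2 → ℂ), H₀ ≤ H →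
      Module.finrank ℚ ↥(IntermediateField.adjoin ℚ (Set.range γ)) ≤ d →
      (∀ i, ∃ P : Polynomial ℤ, P ≠ 0 ∧ P.natDegree ≤ d ∧ (∀ k, |P.coeff k| ≤ (H : ℤ)) ∧
        Polynomial.aeval (γ i) P = 0) →
      Real.exp (-(C * ((d : ℝ) ^ a * Real.log H + (d : ℝ) ^ b))) ≤
        ‖γ - ![(Real.pi : ℂ), (Real.exp 1 : ℂ)]‖ := by
  rintro ⟨a, b, C, ha, hC, hall⟩
  classical
  refine stub_anchoredSyncCore ![(Real.pi : ℂ), (Real.exp 1 : ℂ)] 0 {1} (by simp) ?_ ?_ a b C hC ?_ hall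
  · intro i hi
    rw [Finset.mem_singleton] at hi
    subst hi
    exact ⟨1, isAlgebraic_one, one_ne_zero, by simp [Complex.ofReal_exp]⟩
  · intro i hi hi0
    exfalso
    fin_cases i <;> simp at hi hi0
  · rw [Finset.image_singleton, Finset.card_singleton]
    norm_num at ha ⊢
    exact ha

/-- **The window of `EPiSimultaneousTypeEv` is `[1/2, 1)`, unconditionally:** any witness `(a, b, C)` of the
route item (stated `a < 1`) has `a ≥ 1/2`. [cite: Bugeaud2004, Thm 8.11] -/
theorem epiSimultaneousTypeEv_window
    (h : Summit.Schanuel.Schanuel.Theses.DiophantineDichotomy.EPiSimultaneousTypeEv) :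
    ∃ a b C : ℝ, 1 / 2 ≤ a ∧ a < 1 ∧ 0 < C ∧ ∀ d : ℕ, ∃ H₀ : ℕ, ∀ (H : ℕ) (γ : Fin 2 → ℂ), H₀ ≤ H →
      Module.finrank ℚ ↥(IntermediateField.adjoin ℚ (Set.range γ)) ≤ d →
      (∀ i, ∃ P : Polynomial ℤ, P ≠ 0 ∧ P.natDegree ≤ d ∧ (∀ k, |P.coeff k| ≤ (H : ℤ)) ∧
        Polynomial.aeval (γ i) P = 0) →
      Real.exp (-(C * ((d : ℝ) ^ a * Real.log H + (d : ℝ) ^ b))) ≤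
        ‖γ - ![(Real.pi : ℂ), (Real.exp 1 : ℂ)]‖ := by
  obtain ⟨a, b, C, ha, hC, hall⟩ := h
  refine ⟨a, b, C, ?_, ha, hC, hall⟩
  by_contra hlt
  exact epiSimultaneousTypeEv_exponent_ge_half ⟨a, b, C, not_le.mp hlt, hC, hall⟩

end Summit.Schanuel.Schanuel.Cruxes.KhovanskiiApproxTypeEv.AnchoredReduction

end
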